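import Summits.QuantumFields.BalabanUV.Beta.FP.ExpLocalisedBubbleOrder2Point

/-!
# `BalabanUV.Beta.FP.ExpLocalisedBubbleMarginals` — road «FP», N7 H-route, row H2-ASM-1 (engine, part 3): SECOND MOMENTS OF PRODUCT WEIGHTS, MARGINALS OF
# TWO-POINT EXPONENTIALLY LOCALISED WEIGHTS AND THEIR FUBINI IDENTITIES, crude smear bounds ([folklore] lattice bookkeeping; nothing of the manuscripts)

HONEST DEPENDENCY (page 1, mandatory): continuum YM on T⁴ ⇐ BetaPertH ∧ nine spine estimates (0/9 proved); BetaPertH ⇐ (D1) ∧ (D4) ∧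
CAP+tail; G-an2-4 gates asym, D1 and NE2/3/4.  HONEST FRAMING (cell contract, verbatim): «discharging `BetaPertH` makes Bałaban's UV
stability UNCONDITIONAL — a real constructive-QFT result; it is NOT the continuum limit and NOT the Clay problem.»  THIS MODULE is elementary [folklore] real
analysis on `ℤ^D` ∕ `ℤ⁴` (absolutely convergent double series: products, fibres, Fubini); every analytic input is a HYPOTHESIS; no `def`, no `Prop` fact, nothing
cited, 0 sorry.  NOT the bubble of the perfect theory, NOT `hgerm`, NOT `hasym`, NOT D1, NOT BetaPertH, NOT continuum, NOT Clay.

ROW: `H2V-DESIGN.md` f78878bd5f8d2d18 §4 H2-ASM-1 (owner d1-p3-g6; first refusal of this lineage, R-FP-23 (c)).  Parts 1–2 = `FP/ExpLocalisedBubbleOrder2{,Point}`; the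
double smear (H2-ASM-1 proper) = `FP/ExpLocalisedBubbleMixed`, which reduces every explicit term to smears against PRODUCTS OF MARGINALS — this file's currency.

CONTENT.
* §3 profiles: `abs_coord_mul_coord_le_one`, `summable_abs_secondMoment_of_profile`, **`secondMoment_product`**
  (`Σ' v x·v′ y·(x−y)_i(x−y)_j = (Σ' x_ix_j v)(Σ'v′) − (Σ' x_i v)(Σ' y_j v′) − (Σ' x_j v)(Σ' y_i v′) + (Σ'v)(Σ' y_iy_j v′)`).
* §4 marginals of a two-point weight `|c(x,x′)| ≤ C·e^{−δ(|x|₁+|x′|₁)}` on `ℤ⁴ × ℤ⁴`: fibre summability, **`abs_marginal_snd_le`** (`|Σ'_x c(x,x′)| ≤ C·Zl 4 δ·e^{−δ|x′|₁}`),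
  `abs_marginal_fst_le`, **`abs_marginalMoment_snd_le`** (`|Σ'_x x_κ·c(x,x′)| ≤ C·Zm δ 1·e^{−δ|x′|₁}`); summabilities `summable_mul_fst`∕`summable_mul_snd`; the Fubini identities
  `tsum_marginal_snd`∕`tsum_marginal_fst` (`= Σ'c`), `tsum_mul_marginal_snd` (`Σ'_{x′} x′_κ·Σ'_x c(x,x′) = Σ' c p·(p.2)_κ`), `tsum_mul_marginal_fst`, `tsum_marginalMoment_snd`
  (`Σ'_{x′} Σ'_x x_κ·c(x,x′) = Σ' c p·(p.1)_κ`).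
* §5 crude smear bounds: `abs_smear_le` (`|Σ' c p·F(z+p.1−p.2)| ≤ C·Θ δ 0·A₀` for `|F| ≤ A₀`), `abs_tsum_weight_le` (`|Σ' c| ≤ C·Θ δ 0`).
Unit `b2b-balaban-beta-d1-formalise-leaf-02` (gen 8).
-/

noncomputable section

namespace Summit.QuantumFields.BalabanUV.Beta.FP.ExpLocalisedBubbleMarginals

open Finset Filter Topology fwdDiff
open scoped BigOperators
open Literature.MathematicalPhysics.QuantumFieldTheory.Balaban1983to89
open Literature.MathematicalPhysics.QuantumFieldTheory.Balaban1983to89.Beta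
open B12Sec2to5 (l1 l1_nonneg abs_coord_le_l1)
open ExpKernelCalculus (Site Zl Zl_pos)
open Summit.QuantumFields.BalabanUV.Beta.FP.StencilMoments (summable_of_weight_exp)
open Summit.QuantumFields.BalabanUV.Beta.FP.HorizontalBookkeepingTail (hasSum_mul)
open Summit.QuantumFields.BalabanUV.Beta.FP.ExpLocalisedBubble
open Summit.QuantumFields.BalabanUV.Beta.FP.ExpLocalisedBubblePoint
open Summit.QuantumFields.BalabanUV.Beta.FP.ExpLocalisedBubbleProduct
open Summit.QuantumFields.BalabanUV.Beta.FP.ExpLocalisedBubbleOrder2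
open Summit.QuantumFields.BalabanUV.Beta.FP.ExpLocalisedBubbleOrder2Point
open DyadicShell (Pt supNorm supNorm_eq_zero_iff)

/-! ## §3 Profiles: moments up to order two; second moments of a product weight -/

section Profiles

variable {D : ℕ}

/-- [folklore] `|x_i·x_j| ≤ (|x|₁+1)²`. -/
theorem abs_coord_mul_coord_le_one (x : Site D) (i j : Fin D) : |(x i : ℝ) * (x j : ℝ)| ≤ (l1 x + 1) ^ 2 := by
  rw [abs_mul, sq]
  have hi : |(x i : ℝ)| ≤ l1 x + 1 := (abs_coord_le_l1 x i).trans (by linarith)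
  have hj : |(x j : ℝ)| ≤ l1 x + 1 := (abs_coord_le_l1 x j).trans (by linarith)
  exact mul_le_mul hi hj (abs_nonneg _) (by linarith [l1_nonneg x])

/-- [folklore] An exponential profile has absolutely summable SECOND moments. -/
theorem summable_abs_secondMoment_of_profile {v : Site D → ℝ} {C₁ δ : ℝ} (hδ : 0 < δ) (hv : ∀ x, |v x| ≤ C₁ * Real.exp (-δ * l1 x))
    (i j : Fin D) : Summable fun x => |(x i : ℝ) * (x j : ℝ) * v x| := by
  have hC₁ : 0 ≤ C₁ := by
    have h := hv 0
    have e : l1 (0 : Site D) = 0 := by unfold l1; simp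
    rw [e, mul_zero, Real.exp_zero, mul_one] at h
    exact (abs_nonneg _).trans h
  have h2 := (summable_of_weight_exp (q := (0 : Site D)) (k := 2) hδ hC₁ (g := fun x => (x i : ℝ) * (x j : ℝ) * v x) (fun x => by
    rw [sub_zero, abs_mul]
    calc |(x i : ℝ) * (x j : ℝ)| * |v x| ≤ (l1 x + 1) ^ 2 * (C₁ * Real.exp (-δ * l1 x)) :=
          mul_le_mul (abs_coord_mul_coord_le_one x i j) (hv x) (abs_nonneg _) (by positivity)
      _ = C₁ * (l1 x + 1) ^ 2 * Real.exp (-δ * l1 x) := by ring)).1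
  exact h2.abs

/-- **THE SECOND MOMENTS OF A PRODUCT WEIGHT FACTOR**:
`Σ'_{x,y} v x·v′ y·(x−y)_i(x−y)_j = (Σ' x_ix_j·v)(Σ'v′) − (Σ' x_i·v)(Σ' y_j·v′) − (Σ' x_j·v)(Σ' y_i·v′) + (Σ'v)(Σ' y_iy_j·v′)`. [folklore] -/
theorem secondMoment_product {v v' : Site D → ℝ} {C₁ C₂ δ : ℝ} (hδ : 0 < δ) (hv : ∀ x, |v x| ≤ C₁ * Real.exp (-δ * l1 x))
    (hv' : ∀ y, |v' y| ≤ C₂ * Real.exp (-δ * l1 y)) (i j : Fin D) :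
    ∑' p : Site D × Site D, v p.1 * v' p.2 * ((((p.1 - p.2) i : ℤ) : ℝ) * (((p.1 - p.2) j : ℤ) : ℝ))
      = (∑' x, (x i : ℝ) * (x j : ℝ) * v x) * (∑' y, v' y) - (∑' x, (x i : ℝ) * v x) * (∑' y, (y j : ℝ) * v' y)
        - (∑' x, (x j : ℝ) * v x) * (∑' y, (y i : ℝ) * v' y) + (∑' x, v x) * (∑' y, (y i : ℝ) * (y j : ℝ) * v' y) := by
  obtain ⟨hva, hvi⟩ := summable_abs_of_profile hδ hv
  obtain ⟨hv'a, hv'i⟩ := summable_abs_of_profile hδ hv'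
  have hvij := summable_abs_secondMoment_of_profile hδ hv i j
  have hv'ij := summable_abs_secondMoment_of_profile hδ hv' i j
  have H1 := hasSum_mul (w := fun x => (x i : ℝ) * (x j : ℝ) * v x) (w' := v') hvij hv'a
  have H2 := hasSum_mul (w := fun x => (x i : ℝ) * v x) (w' := fun y => (y j : ℝ) * v' y) (hvi i) (hv'i j)
  have H3 := hasSum_mul (w := fun x => (x j : ℝ) * v x) (w' := fun y => (y i : ℝ) * v' y) (hvi j) (hv'i i)
  have H4 := hasSum_mul (w := v) (w' := fun y => (y i : ℝ) * (y j : ℝ) * v' y) hva hv'ij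
  have H := ((H1.sub H2).sub H3).add H4
  exact (H.congr_fun fun p => by simp only [Pi.sub_apply, Int.cast_sub]; ring).tsum_eq

end Profiles

/-! ## §4 Marginals of a two-point exponentially localised weight on `ℤ⁴ × ℤ⁴` -/

section Marginals

variable {c : Pt × Pt → ℝ} {C δ : ℝ}

/-- [folklore] `x ↦ e^{−δ|x|₁}` is summable on `ℤ⁴` with sum `Zl 4 δ`. -/
theorem hasSum_exp_l1 (hδ : 0 < δ) : HasSum (fun x : Pt => Real.exp (-δ * l1 x)) (Zl 4 δ) := by
  have h := (summable_expWeight_pow (D := 4) hδ 0).1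
  simp only [pow_zero, one_mul] at h
  exact h.hasSum

/-- [folklore] The fibres of a two-point localised weight are absolutely summable (second variable fixed). -/
theorem summable_abs_fibre_snd (hδ : 0 < δ) (hc : ∀ p : Pt × Pt, |c p| ≤ C * (Real.exp (-δ * l1 p.1) * Real.exp (-δ * l1 p.2))) (x' : Pt) :
    Summable fun x : Pt => |c (x, x')| := by
  refine Summable.of_nonneg_of_le (fun _ => abs_nonneg _) (fun x => hc (x, x')) ?_
  exact (((hasSum_exp_l1 hδ).summable).mul_right (Real.exp (-δ * l1 x'))).mul_left C |>.congr fun x => by ring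

/-- [folklore] The fibres of a two-point localised weight are absolutely summable (first variable fixed). -/
theorem summable_abs_fibre_fst (hδ : 0 < δ) (hc : ∀ p : Pt × Pt, |c p| ≤ C * (Real.exp (-δ * l1 p.1) * Real.exp (-δ * l1 p.2))) (x : Pt) :
    Summable fun x' : Pt => |c (x, x')| := by
  refine Summable.of_nonneg_of_le (fun _ => abs_nonneg _) (fun x' => hc (x, x')) ?_
  exact (((hasSum_exp_l1 hδ).summable).mul_left (C * Real.exp (-δ * l1 x))).congr fun x' => by ring

/-- **A MARGINAL IS A PROFILE** (mass marginal over the first variable): `|Σ'_x c(x,x′)| ≤ C·Zl 4 δ·e^{−δ|x′|₁}`. [folklore] -/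
theorem abs_marginal_snd_le (hδ : 0 < δ) (hc : ∀ p : Pt × Pt, |c p| ≤ C * (Real.exp (-δ * l1 p.1) * Real.exp (-δ * l1 p.2))) (x' : Pt) :
    |∑' x : Pt, c (x, x')| ≤ (C * Zl 4 δ) * Real.exp (-δ * l1 x') := by
  have h := norm_tsum_le_tsum_norm (summable_abs_fibre_snd hδ hc x').of_abs.norm
  simp only [Real.norm_eq_abs] at h
  refine h.trans ?_
  have H : HasSum (fun x : Pt => C * (Real.exp (-δ * l1 x) * Real.exp (-δ * l1 x'))) (C * (Zl 4 δ * Real.exp (-δ * l1 x'))) :=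
    ((hasSum_exp_l1 hδ).mul_right _).mul_left C
  calc ∑' x : Pt, |c (x, x')| ≤ ∑' x : Pt, C * (Real.exp (-δ * l1 x) * Real.exp (-δ * l1 x')) :=
        (summable_abs_fibre_snd hδ hc x').tsum_le_tsum (fun x => hc (x, x')) H.summable
    _ = (C * Zl 4 δ) * Real.exp (-δ * l1 x') := by rw [H.tsum_eq]; ring

/-- **A MARGINAL IS A PROFILE** (mass marginal over the second variable): `|Σ'_{x′} c(x,x′)| ≤ C·Zl 4 δ·e^{−δ|x|₁}`. [folklore] -/
theorem abs_marginal_fst_le (hδ : 0 < δ) (hc : ∀ p : Pt × Pt, |c p| ≤ C * (Real.exp (-δ * l1 p.1) * Real.exp (-δ * l1 p.2))) (x : Pt) :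
    |∑' x' : Pt, c (x, x')| ≤ (C * Zl 4 δ) * Real.exp (-δ * l1 x) := by
  have h := norm_tsum_le_tsum_norm (summable_abs_fibre_fst hδ hc x).of_abs.norm
  simp only [Real.norm_eq_abs] at h
  refine h.trans ?_
  have H : HasSum (fun x' : Pt => C * (Real.exp (-δ * l1 x) * Real.exp (-δ * l1 x'))) (C * (Real.exp (-δ * l1 x) * Zl 4 δ)) :=
    ((hasSum_exp_l1 hδ).mul_left _).mul_left C
  calc ∑' x' : Pt, |c (x, x')| ≤ ∑' x' : Pt, C * (Real.exp (-δ * l1 x) * Real.exp (-δ * l1 x')) :=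
        (summable_abs_fibre_fst hδ hc x).tsum_le_tsum (fun x' => hc (x, x')) H.summable
    _ = (C * Zl 4 δ) * Real.exp (-δ * l1 x) := by rw [H.tsum_eq]; ring

/-- **A MOMENT-MARGINAL IS A PROFILE**: `|Σ'_x c(x,x′)·x_κ| ≤ C·Zm δ 1·e^{−δ|x′|₁}`. [folklore] -/
theorem abs_marginalMoment_snd_le (hδ : 0 < δ) (hc : ∀ p : Pt × Pt, |c p| ≤ C * (Real.exp (-δ * l1 p.1) * Real.exp (-δ * l1 p.2)))
    (x' : Pt) (κ : Fin 4) : |∑' x : Pt, (x κ : ℝ) * c (x, x')| ≤ (C * Zm δ 1) * Real.exp (-δ * l1 x') := by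
  have hC := nonneg_of_loc hc
  obtain ⟨hs1, hb1⟩ := tsum_expWeight_pow_le_Zm hδ 1
  have H : HasSum (fun x : Pt => (C * Real.exp (-δ * l1 x')) * ((l1 x + 1) ^ 1 * Real.exp (-δ * l1 x)))
      ((C * Real.exp (-δ * l1 x')) * ∑' x : Pt, (l1 x + 1) ^ 1 * Real.exp (-δ * l1 x)) := hs1.hasSum.mul_left _
  have hdom : ∀ x : Pt, ‖(x κ : ℝ) * c (x, x')‖ ≤ (C * Real.exp (-δ * l1 x')) * ((l1 x + 1) ^ 1 * Real.exp (-δ * l1 x)) := by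
    intro x
    rw [Real.norm_eq_abs, abs_mul, pow_one, mul_comm]
    have h1 := hc (x, x')
    have h2 : |(x κ : ℝ)| ≤ l1 x + 1 := (abs_coord_le_l1 x κ).trans (by linarith)
    calc |c (x, x')| * |(x κ : ℝ)| ≤ C * (Real.exp (-δ * l1 x) * Real.exp (-δ * l1 x')) * (l1 x + 1) :=
          mul_le_mul h1 h2 (abs_nonneg _) (by positivity)
      _ = _ := by ring
  have h := tsum_of_norm_bounded H hdom
  rw [Real.norm_eq_abs] at h
  refine h.trans ?_
  have : 0 ≤ C * Real.exp (-δ * l1 x') := by positivity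
  calc (C * Real.exp (-δ * l1 x')) * ∑' x : Pt, (l1 x + 1) ^ 1 * Real.exp (-δ * l1 x) ≤ (C * Real.exp (-δ * l1 x')) * Zm δ 1 :=
        mul_le_mul_of_nonneg_left hb1 this
    _ = (C * Zm δ 1) * Real.exp (-δ * l1 x') := by ring

/-- [folklore] `p ↦ c p·(p.1)_κ` is summable. -/
theorem summable_mul_fst (hδ : 0 < δ) (hc : ∀ p : Pt × Pt, |c p| ≤ C * (Real.exp (-δ * l1 p.1) * Real.exp (-δ * l1 p.2))) (κ : Fin 4) :
    Summable fun p : Pt × Pt => c p * (p.1 κ : ℝ) := by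
  refine Summable.of_norm_bounded (summable_loc_mul_pow hδ hc 1) (fun p => ?_)
  rw [Real.norm_eq_abs, abs_mul, pow_one]
  refine mul_le_mul_of_nonneg_left ((abs_coord_le_l1 p.1 κ).trans ?_) (abs_nonneg _)
  linarith [l1_nonneg p.1, l1_nonneg p.2]

/-- [folklore] `p ↦ c p·(p.2)_κ` is summable. -/
theorem summable_mul_snd (hδ : 0 < δ) (hc : ∀ p : Pt × Pt, |c p| ≤ C * (Real.exp (-δ * l1 p.1) * Real.exp (-δ * l1 p.2))) (κ : Fin 4) :
    Summable fun p : Pt × Pt => c p * (p.2 κ : ℝ) := by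
  refine Summable.of_norm_bounded (summable_loc_mul_pow hδ hc 1) (fun p => ?_)
  rw [Real.norm_eq_abs, abs_mul, pow_one]
  refine mul_le_mul_of_nonneg_left ((abs_coord_le_l1 p.2 κ).trans ?_) (abs_nonneg _)
  linarith [l1_nonneg p.1, l1_nonneg p.2]

/-- **FUBINI FOR THE MASS MARGINAL** (over the first variable): `Σ'_{x′} Σ'_x c(x,x′) = Σ' c`. [folklore] -/
theorem tsum_marginal_snd (hδ : 0 < δ) (hc : ∀ p : Pt × Pt, |c p| ≤ C * (Real.exp (-δ * l1 p.1) * Real.exp (-δ * l1 p.2))) :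
    ∑' x' : Pt, ∑' x : Pt, c (x, x') = ∑' p : Pt × Pt, c p := by
  have hw := summable_weight hδ hc
  have hu : Summable (Function.uncurry fun x x' : Pt => c (x, x')) := hw.congr fun _ => rfl
  calc ∑' x' : Pt, ∑' x : Pt, c (x, x') = ∑' x : Pt, ∑' x' : Pt, c (x, x') := hu.tsum_comm
    _ = ∑' p : Pt × Pt, c p := hw.tsum_prod.symm

/-- **FUBINI FOR THE MASS MARGINAL** (over the second variable): `Σ'_x Σ'_{x′} c(x,x′) = Σ' c`. [folklore] -/
theorem tsum_marginal_fst (hδ : 0 < δ) (hc : ∀ p : Pt × Pt, |c p| ≤ C * (Real.exp (-δ * l1 p.1) * Real.exp (-δ * l1 p.2))) :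
    ∑' x : Pt, ∑' x' : Pt, c (x, x') = ∑' p : Pt × Pt, c p :=
  ((summable_weight hδ hc).tsum_prod).symm

/-- **FIRST MOMENT OF THE MASS MARGINAL**: `Σ'_{x′} x′_κ·Σ'_x c(x,x′) = Σ' c p·(p.2)_κ`. [folklore] -/
theorem tsum_mul_marginal_snd (hδ : 0 < δ) (hc : ∀ p : Pt × Pt, |c p| ≤ C * (Real.exp (-δ * l1 p.1) * Real.exp (-δ * l1 p.2))) (κ : Fin 4) :
    ∑' x' : Pt, (x' κ : ℝ) * ∑' x : Pt, c (x, x') = ∑' p : Pt × Pt, c p * (p.2 κ : ℝ) := by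
  have hw := summable_mul_snd hδ hc κ
  have hu : Summable (Function.uncurry fun x x' : Pt => c (x, x') * (x' κ : ℝ)) := hw.congr fun _ => rfl
  calc ∑' x' : Pt, (x' κ : ℝ) * ∑' x : Pt, c (x, x') = ∑' x' : Pt, ∑' x : Pt, c (x, x') * (x' κ : ℝ) := by
        refine tsum_congr fun x' => ?_
        rw [← tsum_mul_left]
        exact tsum_congr fun x => by ring
    _ = ∑' x : Pt, ∑' x' : Pt, c (x, x') * (x' κ : ℝ) := hu.tsum_comm
    _ = ∑' p : Pt × Pt, c p * (p.2 κ : ℝ) := hw.tsum_prod.symm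

/-- **FIRST MOMENT OF THE MASS MARGINAL** (second variable summed): `Σ'_x x_κ·Σ'_{x′} c(x,x′) = Σ' c p·(p.1)_κ`. [folklore] -/
theorem tsum_mul_marginal_fst (hδ : 0 < δ) (hc : ∀ p : Pt × Pt, |c p| ≤ C * (Real.exp (-δ * l1 p.1) * Real.exp (-δ * l1 p.2))) (κ : Fin 4) :
    ∑' x : Pt, (x κ : ℝ) * ∑' x' : Pt, c (x, x') = ∑' p : Pt × Pt, c p * (p.1 κ : ℝ) := by
  have hw := summable_mul_fst hδ hc κ
  calc ∑' x : Pt, (x κ : ℝ) * ∑' x' : Pt, c (x, x') = ∑' x : Pt, ∑' x' : Pt, c (x, x') * (x κ : ℝ) := by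
        refine tsum_congr fun x => ?_
        rw [← tsum_mul_left]
        exact tsum_congr fun x' => by ring
    _ = ∑' p : Pt × Pt, c p * (p.1 κ : ℝ) := hw.tsum_prod.symm

/-- **THE MOMENT-MARGINAL SUMS TO THE FIRST MOMENT**: `Σ'_{x′} Σ'_x x_κ·c(x,x′) = Σ' c p·(p.1)_κ`. [folklore] -/
theorem tsum_marginalMoment_snd (hδ : 0 < δ) (hc : ∀ p : Pt × Pt, |c p| ≤ C * (Real.exp (-δ * l1 p.1) * Real.exp (-δ * l1 p.2))) (κ : Fin 4) :
    ∑' x' : Pt, ∑' x : Pt, (x κ : ℝ) * c (x, x') = ∑' p : Pt × Pt, c p * (p.1 κ : ℝ) := by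
  have hw := summable_mul_fst hδ hc κ
  have hw' : Summable fun p : Pt × Pt => (p.1 κ : ℝ) * c p := hw.congr fun _ => mul_comm _ _
  have hu : Summable (Function.uncurry fun x x' : Pt => (x κ : ℝ) * c (x, x')) := hw'.congr fun _ => rfl
  calc ∑' x' : Pt, ∑' x : Pt, (x κ : ℝ) * c (x, x') = ∑' x : Pt, ∑' x' : Pt, (x κ : ℝ) * c (x, x') := hu.tsum_comm
    _ = ∑' p : Pt × Pt, (p.1 κ : ℝ) * c p := hw'.tsum_prod.symm
    _ = ∑' p : Pt × Pt, c p * (p.1 κ : ℝ) := tsum_congr fun p => mul_comm _ _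

end Marginals


/-! ## §5 Crude smear bounds -/

section Crude

variable {c : Pt × Pt → ℝ} {F : Pt → ℝ} {C δ A₀ : ℝ}

/-- [folklore] `|Σ' c| ≤ Σ'|c| ≤ C·Θ δ 0`. -/
theorem abs_tsum_weight_le (hδ : 0 < δ) (hc : ∀ p : Pt × Pt, |c p| ≤ C * (Real.exp (-δ * l1 p.1) * Real.exp (-δ * l1 p.2))) :
    |∑' p : Pt × Pt, c p| ≤ C * Θ δ 0 := by
  have hw := summable_weight hδ hc
  have h := norm_tsum_le_tsum_norm hw.norm
  simp only [Real.norm_eq_abs] at h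
  have h0 := tsum_loc_mul_pow_le hδ hc 0
  calc |∑' p : Pt × Pt, c p| ≤ ∑' p : Pt × Pt, |c p| := h
    _ = ∑' p : Pt × Pt, |c p| * ((l1 p.1 + 1) + (l1 p.2 + 1)) ^ 0 := by simp
    _ ≤ C * Θ δ 0 := h0

/-- [folklore] THE CRUDE SMEAR BOUND: `|F| ≤ A₀` ⟹ `|Σ' c p·F(z+p.1−p.2)| ≤ C·Θ δ 0·A₀`. -/
theorem abs_smear_le (hδ : 0 < δ) (hc : ∀ p : Pt × Pt, |c p| ≤ C * (Real.exp (-δ * l1 p.1) * Real.exp (-δ * l1 p.2)))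
    (hA : ∀ t, |F t| ≤ A₀) (z : Pt) : |∑' p : Pt × Pt, c p * F (z + p.1 - p.2)| ≤ C * Θ δ 0 * A₀ := by
  have hA0 : 0 ≤ A₀ := (abs_nonneg _).trans (hA z)
  have h0 := summable_loc_mul_pow hδ hc 0
  simp only [pow_zero, mul_one] at h0
  have h := tsum_of_norm_bounded (h0.mul_right A₀).hasSum (f := fun p : Pt × Pt => c p * F (z + p.1 - p.2)) (fun p => by
    rw [Real.norm_eq_abs, abs_mul]; exact mul_le_mul_of_nonneg_left (hA _) (abs_nonneg _))
  rw [Real.norm_eq_abs, tsum_mul_right] at h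
  refine h.trans (mul_le_mul_of_nonneg_right ?_ hA0)
  have h0b := tsum_loc_mul_pow_le hδ hc 0
  calc ∑' p : Pt × Pt, |c p| = ∑' p : Pt × Pt, |c p| * ((l1 p.1 + 1) + (l1 p.2 + 1)) ^ 0 := by simp
    _ ≤ C * Θ δ 0 := h0b

end Crude

end Summit.QuantumFields.BalabanUV.Beta.FP.ExpLocalisedBubbleMarginals

end
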